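import Summits.BirchSwinnertonDyer.BirchSwinnertonDyer.Theorems.ManinLocalTwoThreeStevensIntegralityCES
import Summits.BirchSwinnertonDyer.BirchSwinnertonDyer.Theorems.ManinLocalTwoThreeGammaOneLedgerEdges
import Summits.BirchSwinnertonDyer.BirchSwinnertonDyer.Theorems.ManinLocalTwoThreeManinOfStevensConjectures
import Summits.BirchSwinnertonDyer.BirchSwinnertonDyer.Theorems.ManinLocalTwoThreeShimuraQuotientConjugation
import HarnessLib

/-!
# The Γ₀/Γ₁ ledger of the Manin constant WITHOUT the F-need: consequences of CES being a theorem (route `ManinLocalTwoThree`,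
# cruxes C2 stmt-BirchSwinnertonDyer-22967 / C3 stmt-…-22968; cell bsd-f2-manin, prover p2 gen 25; CES-discharge programme, stage 3 —
# by-name flips)

With `StevensIntegrality.exists_optimal_gamma1ParametrizationData_holds` (`…StevensIntegralityCES`: the named fact CES is a tree theorem)
the cell's Γ₀/Γ₁-ledger edges lose their `(hex : exists_optimal_gamma1ParametrizationData)` binder.  For every globally minimal `W₀/ℚ`
with a lattice-optimal `X₀(N)`-datum `D₀` (Manin constant `c₀`) there is — UNCONDITIONALLY — a `ℚ`-isogenous globally minimal `W₁` with an
OPTIMAL `X₁(N)`-datum `D₁` (Stevens' curve on its minimal model; Manin constant `c₁ ∈ ℤ`) such that: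

* `exists_stevens_partner_of_four_dvd_level_holds` — at `4 ∣ N`: `c₁ ∣ c₀` and `|c₀| ∈ {|c₁|, 2|c₁|}`;
* `exists_stevens_partner_of_nine_dvd_level_holds` — at `9 ∣ N`: `c₁ ∣ c₀` and `|c₀| ∈ {|c₁|, 3|c₁|}`;
* `exists_stevens_partner_natAbs_eq_of_sq_dvd_of_sq_dvd` — at two distinct additive primes (`p² ∣ N`, `q² ∣ N`, `p ≠ q`; e.g. `36 ∣ N`):
  `|c₀| = |c₁|`;

and the route declarations follow BY NAME from hypotheses on Stevens' constant only:

* `maninOddAtFour_of_stevensOdd_of_noDoubling` — **C2 ⟸ (Stevens-odd at `4 ∣ N`) ∧ (no doubling at `4 ∣ N`)**;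
* `maninPrimeToThreeAtNine_of_stevens_of_noTripling` — **C3 ⟸ (Stevens prime-to-`3` at `9 ∣ N`) ∧ (no tripling)**;
* `maninPrimeToThreeAtNine_of_stevensI_II` — **C3 ⟸ Stevens I ∧ Stevens II only** (the index-`9` exclusion is the tree's unconditional
  `not_periodLatticeGamma1_eq_three_mul_periodLattice`);
* `abs_maninConstant₀_eq_one_of_stevensConstantOne_of_sq_dvd_of_sq_dvd` — **Stevens' Conjecture I (`c₁ = ±1`) ALONE ⟹ Manin's
  `|c₀| = 1` for every optimal datum at a level with two distinct additive primes** (e.g. `36 ∣ N`: C2 ∧ C3 there ⟸ Stevens I);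
* `maninOddAtFour_of_stevensConjectures'`, `maninPrimeToThreeAtNine_of_stevensConjectures'` — LEAD g14's «C2/C3 ⟸ Stevens I ∧ II ∧ index
  exclusion» without the F-need.

HONEST FRAMING: CONDITIONAL theorems in their Stevens hypotheses (Stevens' conjectures are OPEN; the tree asserts nothing); the existence
statements are unconditional.  C2, C3, Manin's conjecture and BSD are NOT proved.  No definitions, no named facts, no sorry; standard axioms.
[cite: ConradEdixhovenStein2003, §6.1, Lemma 6.1.6] [cite: Stevens1989, §2, Conjectures I–III] [cite: CesnaviciusNeururerSaha2023, Lemma 6.5]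
[cite: LingOesterle1991, Thm. 6 (p. 176)]
-/

set_option autoImplicit false
-- lint-debt: the directory name repeats the summit name (sibling precedent `ManinLocalTwoThreeGammaOneLedgerEdges.lean`)
set_option linter.dupNamespace false

noncomputable section

open scoped Classical
open WeierstrassCurve Literature.NumberTheory.EllipticCurves Literature.NumberTheory.EllipticCurves.ModularForms
open Summit.BirchSwinnertonDyer.Rank1Residual.ManinAdditive.KatoCurve
open Summit.BirchSwinnertonDyer.Rank1Residual.ManinConstant
open Summit.BirchSwinnertonDyer.BirchSwinnertonDyer.Theorems.ManinLocalTwoThree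

namespace Summit.BirchSwinnertonDyer.BirchSwinnertonDyer.Theorems.ManinLocalTwoThree.StevensIntegrality

variable {W₀ : WeierstrassCurve ℚ} [W₀.IsElliptic] [W₀.IsGloballyMinimal] {N : ℕ} [NeZero N]

/-! ## §1 Stevens partners, unconditionally -/

/-- **At `4 ∣ N` every lattice-optimal `X₀(N)`-datum has a Stevens partner on a MINIMAL model with `c₁ ∣ c₀` and
`|c₀| ∈ {|c₁|, 2|c₁|}`** — the tree's `exists_stevens_partner_of_four_dvd_level` with its F-need discharged.
[cite: ConradEdixhovenStein2003, §6.1, Lemma 6.1.6] [cite: CesnaviciusNeururerSaha2023, Lemma 6.5] [cite: LingOesterle1991, Thm. 6] -/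
theorem exists_stevens_partner_of_four_dvd_level_holds (D₀ : ModularParametrizationData W₀ N)
    (h₀ : ∀ z ∈ D₀.L.lattice, ∃ w ∈ periodLattice D₀.f, z = D₀.c * w) (h4 : 2 ^ 2 ∣ N) :
    ∃ (W₁ : WeierstrassCurve ℚ) (_ : W₁.IsElliptic) (_ : W₁.IsGloballyMinimal)
      (D₁ : Gamma1ParametrizationData W₁ N), IsIsogenous W₁ W₀ ∧ D₁.IsOptimal ∧
        D₁.maninConstant ∣ D₀.maninConstant ∧
        (D₀.maninConstant.natAbs = D₁.maninConstant.natAbs ∨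
          D₀.maninConstant.natAbs = 2 * D₁.maninConstant.natAbs) :=
  exists_stevens_partner_of_four_dvd_level exists_optimal_gamma1ParametrizationData_holds D₀ h₀ h4

/-- **At `9 ∣ N` every lattice-optimal `X₀(N)`-datum has a Stevens partner on a MINIMAL model with `c₁ ∣ c₀` and
`|c₀| ∈ {|c₁|, 3|c₁|}`.** [cite: ConradEdixhovenStein2003, §6.1, Lemma 6.1.6] [cite: LingOesterle1991, Thm. 6 (p. 176)] -/
theorem exists_stevens_partner_of_nine_dvd_level_holds (D₀ : ModularParametrizationData W₀ N)
    (h₀ : ∀ z ∈ D₀.L.lattice, ∃ w ∈ periodLattice D₀.f, z = D₀.c * w) (h9 : 3 ^ 2 ∣ N) :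
    ∃ (W₁ : WeierstrassCurve ℚ) (_ : W₁.IsElliptic) (_ : W₁.IsGloballyMinimal)
      (D₁ : Gamma1ParametrizationData W₁ N), IsIsogenous W₁ W₀ ∧ D₁.IsOptimal ∧
        D₁.maninConstant ∣ D₀.maninConstant ∧
        (D₀.maninConstant.natAbs = D₁.maninConstant.natAbs ∨
          D₀.maninConstant.natAbs = 3 * D₁.maninConstant.natAbs) := by
  obtain ⟨W₁, i₁, i₂, D₁, hiso, h₁⟩ := exists_optimal_gamma1ParametrizationData_holds W₀ D₀ h₀
  exact ⟨W₁, i₁, i₂, D₁, hiso, h₁, h₁.maninConstant_dvd_maninConstant D₀ hiso,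
    natAbs_maninConstant₀_eq_or_eq_three_mul_of_nine_dvd_level D₁ D₀ hiso h₁ h₀ h9⟩

/-- **At a level with two distinct additive primes (`p² ∣ N`, `q² ∣ N`, `p ≠ q`; e.g. `36 ∣ N`) every lattice-optimal `X₀(N)`-datum has
a Stevens partner on a MINIMAL model with `|c₀| = |c₁|`**: Manin's and Stevens' constants of the class agree up to sign, unconditionally.
[cite: ConradEdixhovenStein2003, §6.1, Lemma 6.1.6] [cite: LingOesterle1991, Thm. 6 (p. 176)] [cite: AtkinLehner1970, Thm. 3] -/
theorem exists_stevens_partner_natAbs_eq_of_sq_dvd_of_sq_dvd (D₀ : ModularParametrizationData W₀ N)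
    (h₀ : ∀ z ∈ D₀.L.lattice, ∃ w ∈ periodLattice D₀.f, z = D₀.c * w) {p q : ℕ} (hp : p.Prime) (hq : q.Prime)
    (hne : p ≠ q) (hp2 : p ^ 2 ∣ N) (hq2 : q ^ 2 ∣ N) :
    ∃ (W₁ : WeierstrassCurve ℚ) (_ : W₁.IsElliptic) (_ : W₁.IsGloballyMinimal)
      (D₁ : Gamma1ParametrizationData W₁ N), IsIsogenous W₁ W₀ ∧ D₁.IsOptimal ∧
        D₀.maninConstant.natAbs = D₁.maninConstant.natAbs := by
  obtain ⟨W₁, i₁, i₂, D₁, hiso, h₁⟩ := exists_optimal_gamma1ParametrizationData_holds W₀ D₀ h₀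
  exact ⟨W₁, i₁, i₂, D₁, hiso, h₁, natAbs_maninConstant₀_eq_of_sq_dvd_level_of_ne D₁ D₀ hiso h₁ h₀ hp hq hne hp2 hq2⟩

/-! ## §2 The route declarations from hypotheses on Stevens' constant alone -/

/-- **C2 BY NAME ⟸ (Stevens-odd at `4 ∣ N`) ∧ (no doubling at `4 ∣ N`)** — the tree's `maninOddAtFour_of_exists_of_stevensOdd_of_noDoubling`
with its F-need discharged.  CONDITIONAL on the two Stevens hypotheses; C2 is not proved. [cite: Stevens1989, §2] [cite: CesnaviciusNeururerSaha2023, Lemma 6.5] -/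
theorem maninOddAtFour_of_stevensOdd_of_noDoubling
    (hS : ∀ (W₁ W₀ : WeierstrassCurve ℚ) [W₁.IsElliptic] [W₁.IsGloballyMinimal] [W₀.IsElliptic]
      [W₀.IsGloballyMinimal] {N : ℕ} [NeZero N] (D₁ : Gamma1ParametrizationData W₁ N)
      (D₀ : ModularParametrizationData W₀ N), IsIsogenous W₁ W₀ → D₁.IsOptimal →
      (∀ z ∈ D₀.L.lattice, ∃ w ∈ periodLattice D₀.f, z = D₀.c * w) → 2 ^ 2 ∣ N →
      ¬ (2 : ℤ) ∣ D₁.maninConstant)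
    (hND : ∀ (W₁ W₀ : WeierstrassCurve ℚ) [W₁.IsElliptic] [W₁.IsGloballyMinimal] [W₀.IsElliptic]
      [W₀.IsGloballyMinimal] {N : ℕ} [NeZero N] (D₁ : Gamma1ParametrizationData W₁ N)
      (D₀ : ModularParametrizationData W₀ N), IsIsogenous W₁ W₀ → D₁.IsOptimal →
      (∀ z ∈ D₀.L.lattice, ∃ w ∈ periodLattice D₀.f, z = D₀.c * w) → 2 ^ 2 ∣ N →
      D₀.maninConstant.natAbs = D₁.maninConstant.natAbs) :
    Summit.BirchSwinnertonDyer.BirchSwinnertonDyer.Theses.ManinLocalTwoThree.ManinOddAtFour :=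
  maninOddAtFour_of_exists_of_stevensOdd_of_noDoubling exists_optimal_gamma1ParametrizationData_holds hS hND

/-- **C3 BY NAME ⟸ (Stevens prime-to-`3` at `9 ∣ N`) ∧ (no tripling at `9 ∣ N`)** — F-need discharged.  CONDITIONAL; C3 is not proved.
[cite: Stevens1989, §2] [cite: LingOesterle1991, Thm. 6 (p. 176)] -/
theorem maninPrimeToThreeAtNine_of_stevens_of_noTripling
    (hS : ∀ (W₁ W₀ : WeierstrassCurve ℚ) [W₁.IsElliptic] [W₁.IsGloballyMinimal] [W₀.IsElliptic]
      [W₀.IsGloballyMinimal] {N : ℕ} [NeZero N] (D₁ : Gamma1ParametrizationData W₁ N)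
      (D₀ : ModularParametrizationData W₀ N), IsIsogenous W₁ W₀ → D₁.IsOptimal →
      (∀ z ∈ D₀.L.lattice, ∃ w ∈ periodLattice D₀.f, z = D₀.c * w) → 3 ^ 2 ∣ N →
      ¬ (3 : ℤ) ∣ D₁.maninConstant)
    (hNT : ∀ (W₁ W₀ : WeierstrassCurve ℚ) [W₁.IsElliptic] [W₁.IsGloballyMinimal] [W₀.IsElliptic]
      [W₀.IsGloballyMinimal] {N : ℕ} [NeZero N] (D₁ : Gamma1ParametrizationData W₁ N)
      (D₀ : ModularParametrizationData W₀ N), IsIsogenous W₁ W₀ → D₁.IsOptimal →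
      (∀ z ∈ D₀.L.lattice, ∃ w ∈ periodLattice D₀.f, z = D₀.c * w) → 3 ^ 2 ∣ N →
      D₀.maninConstant.natAbs = D₁.maninConstant.natAbs) :
    Summit.BirchSwinnertonDyer.BirchSwinnertonDyer.Theses.ManinLocalTwoThree.ManinPrimeToThreeAtNine :=
  maninPrimeToThreeAtNine_of_exists_of_stevens_of_noTripling exists_optimal_gamma1ParametrizationData_holds hS hNT

/-- **Stevens' Conjecture I alone gives Manin's `|c₀| = 1` at every level with two distinct additive primes** (`p² ∣ N`, `q² ∣ N`,
`p ≠ q`; e.g. `36 ∣ N`): the Stevens partner on a minimal model (CES, now a theorem) has `|c₁| = 1` by the conjecture and `|c₀| = |c₁|` by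
the two-traceless-primes ledger.  CONDITIONAL on Stevens I (OPEN); nothing else.  [cite: Stevens1989, §2, Conjecture I]
[cite: LingOesterle1991, Thm. 6 (p. 176)] [cite: ConradEdixhovenStein2003, Lemma 6.1.6] -/
theorem abs_maninConstant₀_eq_one_of_stevensConstantOne_of_sq_dvd_of_sq_dvd (hSt1 : StevensConstantOne)
    (D₀ : ModularParametrizationData W₀ N) (h₀ : ∀ z ∈ D₀.L.lattice, ∃ w ∈ periodLattice D₀.f, z = D₀.c * w)
    {p q : ℕ} (hp : p.Prime) (hq : q.Prime) (hne : p ≠ q) (hp2 : p ^ 2 ∣ N) (hq2 : q ^ 2 ∣ N) :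
    |D₀.maninConstant| = 1 := by
  obtain ⟨W₁, i₁, i₂, D₁, -, h₁, heq⟩ := exists_stevens_partner_natAbs_eq_of_sq_dvd_of_sq_dvd D₀ h₀ hp hq hne hp2 hq2
  have h1 : |D₁.maninConstant| = 1 := hSt1 W₁ D₁ h₁
  rw [Int.abs_eq_natAbs] at h1 ⊢
  rw [heq]
  exact h1

/-- **C2 ⟸ Stevens I ∧ Stevens II (at `4 ∣ N`) ∧ E-an-152b**, LEAD g14's `maninOddAtFour_of_stevensConjectures` with its F-need discharged.
CONDITIONAL on the three OPEN inputs. [cite: Stevens1989, Conjectures I–III] -/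
theorem maninOddAtFour_of_stevensConjectures' (hSt1 : StevensConstantOne)
    (hSt2 : ∀ (W₁ : WeierstrassCurve ℚ) [W₁.IsElliptic] [W₁.IsGloballyMinimal] {N : ℕ} [NeZero N]
      (D₁ : Gamma1ParametrizationData W₁ N), D₁.IsOptimal → 2 ^ 2 ∣ N → IsMaxCovolumeInClass W₁)
    (h152b : Summit.BirchSwinnertonDyer.Rank1Residual.ManinAdditive.ShimuraKernel.ShimuraIndexNeFourAtFour) :
    Summit.BirchSwinnertonDyer.BirchSwinnertonDyer.Theses.ManinLocalTwoThree.ManinOddAtFour :=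
  maninOddAtFour_of_stevensConjectures exists_optimal_gamma1ParametrizationData_holds hSt1 hSt2 h152b

/-- **C3 ⟸ Stevens I ∧ Stevens II (at `9 ∣ N`) ∧ the index-`9` exclusion**, LEAD g14's `maninPrimeToThreeAtNine_of_stevensConjectures` with
its F-need discharged.  CONDITIONAL on the three OPEN inputs. [cite: Stevens1989, Conjectures I–III] -/
theorem maninPrimeToThreeAtNine_of_stevensConjectures' (hSt1 : StevensConstantOne)
    (hSt2 : ∀ (W₁ : WeierstrassCurve ℚ) [W₁.IsElliptic] [W₁.IsGloballyMinimal] {N : ℕ} [NeZero N]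
      (D₁ : Gamma1ParametrizationData W₁ N), D₁.IsOptimal → 3 ^ 2 ∣ N → IsMaxCovolumeInClass W₁)
    (hne9 : ∀ (W₀ : WeierstrassCurve ℚ) [W₀.IsElliptic] [W₀.IsGloballyMinimal] {N : ℕ} [NeZero N]
      (D₀ : ModularParametrizationData W₀ N),
      (∀ z ∈ D₀.L.lattice, ∃ w ∈ periodLattice D₀.f, z = D₀.c * w) → 3 ^ 2 ∣ N →
      ¬ (∀ z : ℂ, z ∈ periodLatticeGamma1 D₀.f ↔ ∃ w ∈ periodLattice D₀.f, z = 3 * w)) :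
    Summit.BirchSwinnertonDyer.BirchSwinnertonDyer.Theses.ManinLocalTwoThree.ManinPrimeToThreeAtNine :=
  maninPrimeToThreeAtNine_of_stevensConjectures exists_optimal_gamma1ParametrizationData_holds hSt1 hSt2 hne9

/-! ## §3 C3 ⟸ Stevens I ∧ II -/

/-- **C3 ⟸ Stevens I ∧ Stevens II (at `9 ∣ N`) only**: LEAD g14's `maninPrimeToThreeAtNine_of_stevensConjectures` with the F-need
discharged (CES) AND the index-`9` exclusion supplied by the tree's unconditional `not_periodLatticeGamma1_eq_three_mul_periodLattice`
(`…ShimuraQuotientConjugation`).  CONDITIONAL on Stevens' two OPEN conjectures; C3 is not proved. [cite: Stevens1989, Conjectures I–III] -/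
theorem maninPrimeToThreeAtNine_of_stevensI_II (hSt1 : StevensConstantOne)
    (hSt2 : ∀ (W₁ : WeierstrassCurve ℚ) [W₁.IsElliptic] [W₁.IsGloballyMinimal] {N : ℕ} [NeZero N]
      (D₁ : Gamma1ParametrizationData W₁ N), D₁.IsOptimal → 3 ^ 2 ∣ N → IsMaxCovolumeInClass W₁) :
    Summit.BirchSwinnertonDyer.BirchSwinnertonDyer.Theses.ManinLocalTwoThree.ManinPrimeToThreeAtNine :=
  maninPrimeToThreeAtNine_of_stevensConjectures' hSt1 hSt2 fun W₀ _ _ _ _ D₀ h₀ _ ↦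
    not_periodLatticeGamma1_eq_three_mul_periodLattice (W₀ := W₀) D₀ h₀

end Summit.BirchSwinnertonDyer.BirchSwinnertonDyer.Theorems.ManinLocalTwoThree.StevensIntegrality

end
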